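import Mathlib.Analysis.Analytic.Basic
import Literature.MathematicalPhysics.KineticTheory.HardSphereEuler
import Literature.Analysis.FunctionSpaces.TorusCalculus
import HarnessLib

/-!
# Classical solutions of the hard-sphere compressible Euler system on `𝕋³`: continuous dependence
on the data and on the reduced diameter at the ideal-gas limit (named fact)

MathematicalPhysics/KineticTheory fact file, third part of the local theory of classical solutions of
the `5 × 5` compressible Euler system of the hard-sphere gas begun in `HardSphereEulerLocalTheory.lean`
((a) `hsEuler_localExistence`, (b) `hsEuler_continuation`; solution notion
`IsHardSphereEulerSolution σ T ρ u θ` of `HardSphereEuler.lean`: `ρ, u, θ` jointly `C^∞` on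
`[0, T) × 𝕋³`, `ρ, θ > 0`, pressure `p = hsPressure σ ρ θ = ρ θ Z(ρσ³)`). Part (c) is the third leg of
Hadamard well-posedness — CONTINUOUS DEPENDENCE of the classical solution on the data, in the strong
(high-norm) sense and on compact sub-intervals of the life span of the reference solution — for the
one-parameter FAMILY of systems `σ ↦ p_σ = ρθZ(ρσ³)` at its ideal-gas end `σ = 0` (`p₀ = ρθ`, the monatomic
ideal gas), where the dependence on `σ` is itself a dependence on data (below).

* T. Kato, *The Cauchy problem for quasi-linear symmetric hyperbolic systems*, Arch. Rational Mech.
  Anal. 58 (1975) 181–205 (not held here; theorem numbering as cited throughout the literature):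
  for quasi-linear symmetric hyperbolic systems `a₀(t, x, u)∂ₜu + ∑ⱼ aⱼ(t, x, u)∂ⱼu + b(t, x, u) = 0`,
  `aⱼ` symmetric, `a₀` positive definite, smooth in their arguments, and data `u₀ ∈ H^s(ℝ^m)`,
  `s > m/2 + 1`, with values in a compact subset of the state domain: Thms I–II — a unique solution
  `u ∈ C([0, T']; H^s) ∩ C¹([0, T']; H^{s-1})`, `T' > 0` depending on `‖u₀‖ₛ` (and the compact set);
  Thm III — the solution depends continuously on `u₀`: if `u₀ⁿ → u₀` in `H^s` then, for `n` large, `uⁿ`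
  exists on `[0, T']` and `uⁿ → u` in `C([0, T']; H^s)`.
* A. Majda, *Compressible Fluid Flow and Systems of Conservation Laws in Several Space Variables*
  (1984), Ch. 2, §2.1, Thms 2.1–2.2 with Corollaries (the same local theory by the energy method; the
  life span is independent of `s`, so `C^∞` data give `C^∞` solutions; continuation while the `C¹` norm
  is bounded and the state stays in a compact set) and Ch. 1 (the Euler system of gas dynamics with a
  general equation of state as the basic symmetrisable example); C. M. Dafermos, *Hyperbolic
  Conservation Laws in Continuum Physics* (2005), Ch. V, Thm 5.1.1 (held; quoted in the sibling file)
  and §5.4 ("For an alternative, functional analytic, approach … see Kato [1] and Taylor [1]");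
  M. E. Taylor, *PDE III* (2011), Ch. 16 §§1–2 (the torus / compact-manifold versions).

## Why the `σ`-family is in scope, and why `σ`-dependence is data-dependence

Under the standing equation-of-state hypothesis of the sibling file (`hsExcessFreeEnergy = F` on
`[0, η₀)` with `F` analytic on `(-η₀, η₀)`; an INPUT, asserted nowhere here) the pressure law of the
family is `P(ρ, θ, s) = ρθ(1 + ρs F′(ρs))` at `s = σ³`, real analytic in `(ρ, θ, s)` on
`{ρ > 0, θ > 0, |ρs| < η₀}`, with `P(ρ, θ, 0) = ρθ`. For classical solutions the specific entropy
`S = (3/2) log θ - log ρ - F(ρs)` is transported (`∂ₜS + u·∇S = 0`), and in the unknowns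
`V = (p, u, S, s)`, with the parameter `s` adjoined as a passively transported scalar
(`∂ₜs + u·∇s = 0`, `s(0, ·) ≡ σ³`), the whole family is ONE quasi-linear symmetric hyperbolic system
`(ρc²)⁻¹(∂ₜp + u·∇p) + div u = 0`, `ρ(∂ₜu + (u·∇)u) + ∇p = 0`, `∂ₜS + u·∇S = 0`, `∂ₜs + u·∇s = 0`
(symmetriser `diag((ρc²)⁻¹, ρ, ρ, ρ, 1, 1)`, sound speed `c² = (∂P/∂ρ)_S = θ[(Z + ηZ′) + (2/3)Z²]`,
`η = ρs`, positive for `|η| ≤ η_c(η₀, F)` small; `(ρ, θ) ↦ (p, S)` is an analytic diffeomorphism there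
since its Jacobian is `(3/2)(Z + ηZ′) + Z² > 0`). A change of `σ` is thus a change of the (constant)
datum `s(0, ·)`, and Kato's Thm III applies to `(p₀, u₀, S₀, σ³) → (p₁(0), u₁(0), S₁(0), 0)`.

## Main statement (named fact, nothing asserted; D-0014)

* `hsEuler_continuousDependence` — (c) CONTINUOUS DEPENDENCE AT THE IDEAL-GAS LIMIT: under the
  equation-of-state hypothesis, for every classical ideal-gas solution `(ρ₁, u₁, θ₁)` (`σ = 0`) on
  `[0, T₁) × 𝕋³`, every `0 < T₂ < T₁` and `ε > 0` there are an order `k` and `δ > 0` such that for all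
  `0 < σ < δ` and all smooth data `(ρ₀ > 0, θ₀ > 0, u₀)` whose periodic lifts are `δ`-close to those of
  `(ρ₁, θ₁, u₁)(0)` together with all derivatives of order `≤ k`, a classical solution of the
  hard-sphere system at reduced diameter `σ` with these data exists on some `[0, T)`, `T > T₂`, and is
  `ε`-close to `(ρ₁, u₁, θ₁)` pointwise on `[0, T) × 𝕋³`.

## Deviations from print (read before use)

1. Special case only: this one family of `5 × 5` systems on `𝕋³`, compared at its end point `σ = 0`;
   the general theorem (any quasi-linear symmetric hyperbolic system, continuity at any datum, in the
   `C([0, T']; H^s)` topology) is the `TODO(general form)` below.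
2. Periodic box `𝕋³` instead of `ℝ³` (as in the sibling file, item 2: the proofs are verbatim on the
   torus, Taylor Ch. 16 §§1–2; on `𝕋³` the constant datum `s(0, ·) ≡ σ³` lies in every `H^s`).
3. Topologies: closeness of the DATA is asked in the `Cᵏ` sup-norms of the periodic lifts
   (`iteratedFDeriv ℝ n (Torus.lift ·)`, `n ≤ k`), which on the unit torus dominate the `H^k(𝕋³)`
   norms (`k = s = 3 > 3/2 + 1` suffices; the fact lets the order `k` depend on the reference
   solution, `T₂` and `ε`, which is weaker than print); closeness of the SOLUTIONS is concluded only
   pointwise (sup norm), which `C([0, T']; H^s)`-closeness implies for `s > 3/2`.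
4. Time interval: print gives continuity on the interval `[0, T']` of Thm II; continuity on an
   arbitrary compact sub-interval `[0, T₂]` of the interval `[0, T₁)` of classical existence of the
   reference solution follows by finitely many restarts from `u(T')`, `u(2T')`, … (the `H^s` norm of
   the reference is bounded on `[0, T₂']`, `T₂ < T₂' < T₁`, so `T'` is bounded below along the way),
   and the perturbed solution is then continued slightly beyond `T₂` inside `[0, T₂']`.
5. Regularity class and positivity: `C^∞` data give jointly `C^∞` solutions on the `H^s` life span
   (sibling file, item 3); `ρ, θ > 0` and packing `ρσ³ < η_c` along the perturbed solution, needed to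
   read it as an `hsPressure`-solution (`IsHardSphereEulerSolution σ`), follow from its closeness to
   the reference, which is bounded with `ρ₁, θ₁` bounded below on `[0, T₂'] × 𝕋³`, once `ε` is
   (harmlessly) decreased and `δ` is small.
6. The reference solves the `σ = 0` system, i.e. `hsPressure 0 ρ θ = ρθ` exactly (no hypothesis on
   `F` is used at `σ = 0`); `0 < σ` in the conclusion excludes nothing of interest and keeps the
   packing `ρσ³ > 0` inside `(0, η₀)`, where `Z = 1 + ηF′`.

## Mathlib / tree search

As recorded in the sibling file: no existence or stability theory for quasilinear hyperbolic systems
in Mathlib or in the tree (the tree has the linear symmetric-hyperbolic energy method on `ℝ^d`,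
`Literature/Analysis/PDE/SymmetricHyperbolic*.lean`, torus Sobolev norms / mollifiers / commutator
estimates under `Literature/Analysis/FunctionSpaces/Torus*.lean`, and relative-energy UNIQUENESS of
classical hard-sphere Euler solutions at small packing on the summit side). This fact is consumed by
name (conditional result) by the hydrodynamic-limit problem of the summit `AtomisticToContinuum`
(route item `EosContinuity`: continuity of admissible classical solutions in the equation-of-state
parameter).

## References

* T. Kato, *The Cauchy problem for quasi-linear symmetric hyperbolic systems*, Arch. Rational Mech.
  Anal. 58 (1975) 181–205: Thms I–III. [`Kato1975`]
* A. Majda, *Compressible Fluid Flow and Systems of Conservation Laws in Several Space Variables*,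
  Appl. Math. Sci. 53, Springer 1984: Ch. 1; Ch. 2, §2.1, Thms 2.1–2.2 and Corollaries. [`Majda1984`]
* C. M. Dafermos, *Hyperbolic Conservation Laws in Continuum Physics*, 2nd ed., Springer 2005: Ch. V,
  Thm 5.1.1, Thm 5.2.1, §5.4. [`Dafermos2005`]
* M. E. Taylor, *Partial Differential Equations III*, 2nd ed., Springer 2011: Ch. 16, §§1–2, §5.
  [`TaylorPDEIII2011`]
-/

noncomputable section

open Set

namespace Literature.MathematicalPhysics.KineticTheory

open Literature.Analysis.FunctionSpaces

/-- **NAMED FACT (c) — continuous dependence of classical solutions of the hard-sphere compressible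
Euler system on the data and on the reduced diameter, at the ideal-gas limit `σ = 0`.** Kato 1975,
Thm III (with Thms I–II): the `H^s` solution, `s > m/2 + 1`, of a quasi-linear symmetric hyperbolic
system `a₀(t, x, u)∂ₜu + ∑ⱼ aⱼ(t, x, u)∂ⱼu + b(t, x, u) = 0` depends continuously on its initial datum —
if `u₀ⁿ → u₀` in `H^s` then for `n` large the solutions `uⁿ` exist on the interval `[0, T']` of the
limit solution and `uⁿ → u` in `C([0, T']; H^s)` (also Majda 1984, Ch. 2, Thms 2.1–2.2; on the torus
Taylor, *PDE III*, Ch. 16 §§1–2). Rendered for the family of hard-sphere systems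
`IsHardSphereEulerSolution σ` on `𝕋³`, which in the unknowns `(p, u, S, s)` — `S` the specific entropy
`(3/2)log θ - log ρ - F(ρs)`, `s ≡ σ³` adjoined as a passively transported scalar — is ONE
quasi-linear symmetric hyperbolic system with symmetriser `diag((ρc²)⁻¹, ρ, ρ, ρ, 1, 1)`,
`c² = θ[(Z + ηZ′) + (2/3)Z²] > 0` at small packing under the equation-of-state hypothesis below, so
that the reduced diameter enters as the constant datum `s(0, ·) = σ³ → 0`; data closeness in `Cᵏ`
sup-norms of the periodic lifts (dominating `H^k(𝕋³)`), solution closeness pointwise (dominated by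
`H^s`, `s > 3/2`), continuity up to any `T₂` below the life span `T₁` of the ideal-gas reference by
finitely many restarts, positivity and small packing of the perturbed solution from its closeness to
the reference (see the module docstring, "Deviations from print"): IF `hsExcessFreeEnergy` agrees on
`[0, η₀)` with some `F` analytic on `(-η₀, η₀)`, THEN for every classical ideal-gas solution
`(ρ₁, u₁, θ₁)` on `[0, T₁)` (`σ = 0`, `p = ρθ`), every `0 < T₂ < T₁` and `ε > 0` there are `k` and
`δ > 0` such that for all `0 < σ < δ` and all smooth data `ρ₀ > 0`, `θ₀ > 0`, `u₀` on `𝕋³` with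
`‖Dⁿ lift(ρ₀ − ρ₁(0))‖, ‖Dⁿ lift(θ₀ − θ₁(0))‖, ‖Dⁿ lift(u₀ − u₁(0))‖ ≤ δ` on `ℝ³` for all `n ≤ k`, there
is a classical solution `(ρ, u, θ)` at reduced diameter `σ` on some `[0, T)`, `T > T₂`, with
`(ρ, u, θ)(0) = (ρ₀, u₀, θ₀)` and `|ρ − ρ₁|, ‖u − u₁‖, |θ − θ₁| < ε` on `[0, T) × 𝕋³`.
[cite: Kato1975, Thm III] -/
def hsEuler_continuousDependence : Prop :=
  ∀ η₀ : ℝ, 0 < η₀ → ∀ F : ℝ → ℝ, AnalyticOnNhd ℝ F (Ioo (-η₀) η₀) →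
    EqOn hsExcessFreeEnergy F (Ico 0 η₀) →
    ∀ (T₁ : ℝ) (ρ₁ θ₁ : ℝ → T3 → ℝ) (u₁ : ℝ → T3 → V3), IsHardSphereEulerSolution 0 T₁ ρ₁ u₁ θ₁ →
      ∀ T₂ : ℝ, 0 < T₂ → T₂ < T₁ → ∀ ε : ℝ, 0 < ε →
      ∃ k : ℕ, ∃ δ : ℝ, 0 < δ ∧ ∀ σ : ℝ, 0 < σ → σ < δ →
        ∀ (ρ₀ θ₀ : T3 → ℝ) (u₀ : T3 → V3),
          Torus.IsSmooth ρ₀ → Torus.IsSmooth θ₀ → Torus.IsSmooth u₀ →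
          (∀ x, 0 < ρ₀ x) → (∀ x, 0 < θ₀ x) →
          (∀ n : ℕ, n ≤ k → ∀ y : EuclideanSpace ℝ (Fin 3),
            ‖iteratedFDeriv ℝ n (Torus.lift fun x => ρ₀ x - ρ₁ 0 x) y‖ ≤ δ) →
          (∀ n : ℕ, n ≤ k → ∀ y : EuclideanSpace ℝ (Fin 3),
            ‖iteratedFDeriv ℝ n (Torus.lift fun x => θ₀ x - θ₁ 0 x) y‖ ≤ δ) →
          (∀ n : ℕ, n ≤ k → ∀ y : EuclideanSpace ℝ (Fin 3),
            ‖iteratedFDeriv ℝ n (Torus.lift fun x => u₀ x - u₁ 0 x) y‖ ≤ δ) →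
          ∃ T : ℝ, T₂ < T ∧ ∃ (ρ θ : ℝ → T3 → ℝ) (u : ℝ → T3 → V3),
            IsHardSphereEulerSolution σ T ρ u θ ∧ ρ 0 = ρ₀ ∧ u 0 = u₀ ∧ θ 0 = θ₀ ∧
            ∀ t ∈ Ico 0 T, ∀ x,
              |ρ t x - ρ₁ t x| < ε ∧ ‖u t x - u₁ t x‖ < ε ∧ |θ t x - θ₁ t x| < ε

-- TODO(general form): Kato 1975 Thm III for quasi-linear symmetric hyperbolic systems on ℝ^m / 𝕋^m:
-- the data-to-solution map H^s → C([0, T']; H^s), s > m/2 + 1, is continuous (and T' is lower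
-- semicontinuous); here only the hard-sphere Euler family, at its ideal-gas end point, in Cᵏ/sup norms.

end Literature.MathematicalPhysics.KineticTheory

end
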